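import Literature.NumberTheory.Transcendental.ReciprocalBricks
import Literature.Algebra.Polynomial.IntegerValuedPolynomials
import HarnessLib

/-!
# Rivoal–Zudilin 2020, Proposition 1 (ii): the bricks of `R(t)(t+m)^A` and `d_n^{A-j} p_{j,m} ∈ ℤ`

Topic `Literature/NumberTheory/Irrationality/RivoalZudilin2020`; proofs-only companion (over `ℚ`) of
`TwoIrrationalOddZetaValues.lean` towards the named fact `proposition1_ii`. Source: T. Rivoal, W. Zudilin,
*A note on odd zeta values*, Sém. Lothar. Combin. **81** (2020) B81b = arXiv:1803.03160 [RivoalZudilin2020],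
§3, proof of Proposition 1 (ii) (arXiv pp. 5–6), first half:

"We can apply mutatis mutandis [zud2] and get that `d_n^{A−j} p_{j,m} ∈ ℤ` for any `j ∈ {1,…,A}` and any
`m ∈ {0,…,n}`. On the other hand, observe that the rational function `R(t)` can be written as
`(2t+n)·F(t)³G(t)^{A−15}` where `F(t) := 2^{6n}(t−n)_n(t+n+1)_n(t−n+½)_{3n}/(t)_{n+1}^5` and
`G(t) := n!/(t)_{n+1}`", and "`d_n^k (1/k!)(G(t)(t+m))^{(k)}_{t=−m} ∈ ℤ`", "using Leibniz's rule for
differentiating products".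

## Rendering (tree vocabulary: Nesterenko bricks of [Zudilin2004, §7], `Transcendental/NesterenkoBricks*`,
`ReciprocalBricks`; book-keeping `IsDInt d N f x` = "`d^j (1/j!) f^{(j)}(x) ∈ ℤ` for `j ≤ N`")

* `Greg n m = recipBrickReg 0 (n+1) m` is `G(t)(t+m) = n!/∏_{k ≤ n, k ≠ m}(t+k)` ([Zudilin2004, Lemma 16]
  gives `IsDInt (d_n)` at `−m`, tree `recipBrickReg_isDInt`);
* `F(t)(t+m)^5` in BRICK FORM `Fbrick n m`: the product of the polynomial bricks `(t−n)_n/n!`,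
  `(t+n+1)_n/n!` ([Zudilin2004, Lemma 15], tree `polyBrick_isDInt`), of the three HALF-INTEGER bricks
  `halfBrick c n t = 2^{2n}(t + c + ½)_n/n!`, `c = −n, 0, n` (so that
  `2^{6n}(t−n+½)_{3n} = n!³ · ∏_c halfBrick c n t`), and of `Greg^5`;
* `RregBrick A n m t = (2t+n) · Fbrick³ · Greg^{A−15}` is `R(t)(t+m)^A` regularised at `−m` (the
  identification with the typed real `rfunReg` is in the sibling `DenominatorsTransfer.lean`).

What is NEW here relative to [Zudilin2004]'s bricks is the half-integer brick: `halfBrick c n` is an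
INTEGER-VALUED polynomial of degree `n` (its value at an integer `k` is `2ⁿ ∏_{j<n}(N+2j)/n!` with
`N = 2k+2c+1`, and `n! ∣ 2ⁿ ∏_{j<n}(N+2j)` for every integer `N`, `factorial_dvd_two_pow_mul_prod`), hence
an integer combination of `binom(t,i)`, `i ≤ n` (tree: `Algebra/Polynomial/IntegerValuedPolynomials`,
Newton–Gregory), hence `IsDInt (d_n)` at every integer (`isDInt_eval_of_intValued`, Lemma 15 for each
`binom(t,i) = polyBrick (1−i) i`). Main result: `RregBrick_isDInt` —
`d_n^j · (1/j!) (R(t)(t+m)^A)^{(j)}|_{t=−m} ∈ ℤ` for all `j` ("`d_n^{A−j} p_{j,m} ∈ ℤ`").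

HONEST FRAMING (cells pub-zeta5 / zeta5-irr): systematic search; no irrationality claim unless certified —
this is denominator arithmetic of a rational function; nothing here concerns `ζ(5)`.
-/

noncomputable section

open Finset Filter Polynomial Literature.Analysis.Calculus
open Literature.NumberTheory.Transcendental
open Literature.Algebra.Polynomial.IntegerValuedPolynomials
open scoped Nat

namespace Literature.NumberTheory.Irrationality.RivoalZudilin2020

/-! ### Integer-valued polynomials are `IsDInt (d_n)` at integers -/

/-- `binom(t, i) = t(t−1)⋯(t−i+1)/i!` is the polynomial brick `polyBrick (1−i) i` (`= (t+1−i)_i/i!`).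
[cite: Zudilin2004, §7 (7.3) and Lemma 15] -/
theorem newtonBinom_eval_eq_polyBrick (i : ℕ) (t : ℚ) :
    (newtonBinom ℚ i).eval t = polyBrick (1 - (i : ℤ)) i t := by
  rw [newtonBinom_eval, polyBrick, div_eq_inv_mul]
  congr 1
  rw [← prod_range_reflect]
  refine prod_congr rfl fun j hj => ?_
  have hj' := mem_range.1 hj
  rw [Nat.cast_sub (by omega), Nat.cast_sub (by omega)]
  push_cast
  ring

/-- A polynomial `P ∈ ℚ[X]` of degree `≤ d` taking integer values at `0, 1, …, d` satisfies
`d_d^j · (1/j!) P^{(j)}(k) ∈ ℤ` for every integer `k` and every `j`: it is an integer combination of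
`binom(t,i)`, `i ≤ d` (Newton–Gregory), and [Zudilin2004, Lemma 15] applies to each `binom(t,i)` with
`d_i ∣ d_d`. [cite: Zudilin2004, §7 Lemma 15 ("well-known properties of integer-valued polynomials")] -/
theorem isDInt_eval_of_intValued (P : ℚ[X]) {d : ℕ} (hP : P.natDegree ≤ d)
    (h : ∀ i : ℕ, i ≤ d → ∃ z : ℤ, P.eval (i : ℚ) = z) (k : ℤ) (N : ℕ) :
    IsDInt (Nat.lcmUpto d) N (fun t => P.eval t) k := by
  obtain ⟨z, hz⟩ := exists_int_newtonBinom_combination P hP h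
  have hsum : IsDInt (Nat.lcmUpto d) N
      (fun t => ∑ i ∈ range (d + 1), (z i : ℚ) * polyBrick (1 - (i : ℤ)) i t) k := by
    refine IsDInt.sum (range (d + 1)) fun i hi => ?_
    have hi' : i ≤ d := Nat.lt_succ_iff.1 (mem_range.1 hi)
    exact ((polyBrick_isDInt (1 - (i : ℤ)) i k N).of_dvd (lcmUpto_dvd_lcmUpto hi')).int_mul (z i)
  refine hsum.congr (Eventually.of_forall fun t => ?_)
  show (∑ i ∈ range (d + 1), (z i : ℚ) * polyBrick (1 - (i : ℤ)) i t) = P.eval t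
  rw [hz, eval_finsetSum]
  refine sum_congr rfl fun i _ => ?_
  rw [eval_mul, eval_C, newtonBinom_eval_eq_polyBrick]

/-! ### `n! ∣ 2ⁿ ∏_{j<n} (N + 2j)` -/

/-- `O_m := 2^m ∏_{j<m} (1 + 2j)` satisfies `O_m · m! = (2m)!`. [folklore] -/
private theorem two_pow_mul_prod_odd_mul_factorial (m : ℕ) :
    (2 : ℤ) ^ m * (∏ j ∈ range m, ((1 : ℤ) + 2 * j)) * m ! = (2 * m) ! := by
  induction m with
  | zero => simp
  | succ m ih =>
    rw [prod_range_succ, Nat.factorial_succ, show 2 * (m + 1) = 2 * m + 1 + 1 by ring,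
      Nat.factorial_succ, Nat.factorial_succ]
    push_cast
    linear_combination (2 * ((m : ℤ) + 1) * (1 + 2 * m)) * ih

/-- The recursion `P_{n+1}(N) − P_{n+1}(N − 2) = 4(n+1) P_n(N)` for `P_n(N) = 2ⁿ ∏_{j<n}(N+2j)`.
[folklore] -/
private theorem two_pow_mul_prod_rec (n : ℕ) (N : ℤ) :
    (2 : ℤ) ^ (n + 1) * ∏ j ∈ range (n + 1), (N + 2 * j)
      = 2 ^ (n + 1) * ∏ j ∈ range (n + 1), (N - 2 + 2 * j) + 4 * (n + 1) * (2 ^ n * ∏ j ∈ range n, (N + 2 * j)) := by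
  rw [prod_range_succ, prod_range_succ' (fun j => N - 2 + 2 * (j : ℤ))]
  have h : ∀ j ∈ range n, N - 2 + 2 * ((j + 1 : ℕ) : ℤ) = N + 2 * j := fun j _ => by push_cast; ring
  rw [prod_congr rfl h]
  push_cast
  ring

/-- **`n! ∣ 2ⁿ ∏_{j<n} (N + 2j)`** for every integer `N` (for odd `N`: `n!` divides `2ⁿ` times a product of
`n` consecutive odd numbers) — the integrality of the values `2^{2n}(k + c + ½)_n/n!` of the half-integer
brick. [cite: RivoalZudilin2020, §3 (proof of Proposition 1 (ii): the factor (t−n+½)_{3n})] -/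
theorem factorial_dvd_two_pow_mul_prod (n : ℕ) (N : ℤ) :
    (n ! : ℤ) ∣ 2 ^ n * ∏ j ∈ range n, (N + 2 * j) := by
  induction n generalizing N with
  | zero => simp
  | succ n ih =>
    -- `G N := (n+1)! ∣ P_{n+1}(N)` is invariant under `N ↦ N − 2`
    have hstep : ∀ M : ℤ, ((n + 1)! : ℤ) ∣ 2 ^ (n + 1) * ∏ j ∈ range (n + 1), (M + 2 * j) ↔
        ((n + 1)! : ℤ) ∣ 2 ^ (n + 1) * ∏ j ∈ range (n + 1), (M - 2 + 2 * j) := by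
      intro M
      have hrec := two_pow_mul_prod_rec n M
      have hdvd : ((n + 1)! : ℤ) ∣ 4 * (n + 1) * (2 ^ n * ∏ j ∈ range n, (M + 2 * j)) := by
        obtain ⟨w, hw⟩ := ih M
        refine ⟨4 * w, ?_⟩
        rw [hw, Nat.factorial_succ]
        push_cast
        ring
      rw [hrec]
      exact ⟨fun h => (dvd_add_left hdvd).1 h, fun h => dvd_add h hdvd⟩
    -- bases `N = 0` (a zero factor) and `N = 1` (`(2n+2)!/(n+1)!`)
    have h0 : ((n + 1)! : ℤ) ∣ 2 ^ (n + 1) * ∏ j ∈ range (n + 1), ((0 : ℤ) + 2 * j) := by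
      rw [prod_eq_zero (i := 0) (mem_range.2 (Nat.succ_pos n)) (by simp)]
      simp
    have h1 : ((n + 1)! : ℤ) ∣ 2 ^ (n + 1) * ∏ j ∈ range (n + 1), ((1 : ℤ) + 2 * j) := by
      have hO := two_pow_mul_prod_odd_mul_factorial (n + 1)
      have hch := Nat.choose_mul_factorial_mul_factorial (Nat.le_mul_of_pos_left (n + 1) two_pos)
      rw [show 2 * (n + 1) - (n + 1) = n + 1 by omega] at hch
      refine ⟨((2 * (n + 1)).choose (n + 1) : ℤ), ?_⟩
      have hf : ((n + 1)! : ℤ) ≠ 0 := by exact_mod_cast Nat.factorial_ne_zero _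
      apply mul_right_cancel₀ hf
      rw [hO, ← Nat.cast_mul, ← hch]
      push_cast
      ring
    -- all pairs `(2q, 2q+1)`, `q ∈ ℤ`
    have hall : ∀ q : ℤ, ((n + 1)! : ℤ) ∣ 2 ^ (n + 1) * ∏ j ∈ range (n + 1), (2 * q + 2 * j) ∧
        ((n + 1)! : ℤ) ∣ 2 ^ (n + 1) * ∏ j ∈ range (n + 1), (2 * q + 1 + 2 * j) := by
      intro q
      induction q using Int.induction_on with
      | zero => exact ⟨by simpa using h0, by simpa using h1⟩
      | succ q hq =>
        refine ⟨(hstep _).2 ?_, (hstep _).2 ?_⟩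
        · have e : (2 * ((q : ℤ) + 1) - 2) = 2 * q := by ring
          rw [e]; exact hq.1
        · have e : (2 * ((q : ℤ) + 1) + 1 - 2) = 2 * q + 1 := by ring
          rw [e]; exact hq.2
      | pred q hq =>
        refine ⟨?_, ?_⟩
        · have := (hstep (2 * (-(q : ℤ)))).1 hq.1
          have e : (2 * (-(q : ℤ)) - 2) = 2 * (-(q : ℤ) - 1) := by ring
          rwa [e] at this
        · have := (hstep (2 * (-(q : ℤ)) + 1)).1 hq.2
          have e : (2 * (-(q : ℤ)) + 1 - 2) = 2 * (-(q : ℤ) - 1) + 1 := by ring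
          rwa [e] at this
    -- `N = 2(N/2) + N % 2`
    rcases Int.emod_two_eq_zero_or_one N with hr | hr
    · have e : N = 2 * (N / 2) := by omega
      rw [e]; exact (hall (N / 2)).1
    · have e : N = 2 * (N / 2) + 1 := by omega
      rw [e]; exact (hall (N / 2)).2

/-! ### The half-integer brick `2^{2n} (t + c + ½)_n / n!` -/

/-- The HALF-INTEGER BRICK `halfBrick c n t = 2^{2n} (t + c + ½)(t + c + 3/2)⋯(t + c + n − ½) / n!`
(`c ∈ ℤ`); `(t−n+½)_{3n} · 2^{6n}/n!³ = halfBrick (−n) n · halfBrick 0 n · halfBrick n n`.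
[cite: RivoalZudilin2020, §2 (the factor 2^{18n}(t−n+½)_{3n}^3 of R(t))] -/
def halfBrick (c : ℤ) (n : ℕ) (t : ℚ) : ℚ :=
  (2 : ℚ) ^ (2 * n) / (n ! : ℚ) * ∏ j ∈ range n, (t + ((c : ℚ) + 1 / 2 + j))

/-- The half-integer brick as a polynomial. [cite: RivoalZudilin2020, §2] -/
def halfBrickPoly (c : ℤ) (n : ℕ) : ℚ[X] :=
  C ((2 : ℚ) ^ (2 * n) / (n ! : ℚ)) * ∏ j ∈ range n, (X + C ((c : ℚ) + 1 / 2 + j))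

/-- `halfBrickPoly` evaluates to `halfBrick`. [cite: RivoalZudilin2020, §2] -/
theorem eval_halfBrickPoly (c : ℤ) (n : ℕ) (t : ℚ) : (halfBrickPoly c n).eval t = halfBrick c n t := by
  rw [halfBrickPoly, halfBrick, eval_mul, eval_C, eval_prod]
  congr 1
  exact prod_congr rfl fun j _ => by rw [eval_add, eval_X, eval_C]

/-- `deg halfBrickPoly c n ≤ n`. [cite: RivoalZudilin2020, §2] -/
theorem natDegree_halfBrickPoly_le (c : ℤ) (n : ℕ) : (halfBrickPoly c n).natDegree ≤ n := by
  unfold halfBrickPoly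
  refine natDegree_mul_le.trans ?_
  rw [natDegree_C, zero_add]
  refine (natDegree_prod_le _ _).trans ?_
  refine (sum_le_sum fun j _ => (natDegree_X_add_C _).le).trans ?_
  simp

/-- The value of the half-integer brick at an integer `k`:
`halfBrick c n k = 2ⁿ ∏_{j<n} (2k + 2c + 1 + 2j) / n!`. [cite: RivoalZudilin2020, §3 (proof of Proposition 1 (ii))] -/
theorem halfBrick_intCast (c : ℤ) (n : ℕ) (k : ℤ) :
    halfBrick c n k = ((2 : ℤ) ^ n * ∏ j ∈ range n, (2 * k + 2 * c + 1 + 2 * (j : ℤ)) : ℤ) / (n ! : ℚ) := by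
  rw [halfBrick]
  have h2 : ∀ j ∈ range n, ((k : ℚ) + ((c : ℚ) + 1 / 2 + j)) = (1 / 2) * (2 * k + 2 * c + 1 + 2 * j) :=
    fun j _ => by ring
  rw [prod_congr rfl h2, prod_mul_distrib, prod_const, card_range]
  push_cast
  have : (2 : ℚ) ^ (2 * n) * (1 / 2) ^ n = 2 ^ n := by
    rw [pow_mul, ← mul_pow]; norm_num
  rw [div_mul_eq_mul_div, ← mul_assoc, this]

/-- The half-integer brick takes INTEGER values at integers. [cite: RivoalZudilin2020, §3 (proof of Proposition 1 (ii))] -/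
theorem halfBrick_intCast_isInt (c : ℤ) (n : ℕ) (k : ℤ) : ∃ z : ℤ, halfBrick c n k = z := by
  obtain ⟨w, hw⟩ := factorial_dvd_two_pow_mul_prod n (2 * k + 2 * c + 1)
  refine ⟨w, ?_⟩
  rw [halfBrick_intCast]
  have e : ∀ j ∈ range n, (2 * k + 2 * c + 1 + 2 * (j : ℤ)) = (2 * k + 2 * c + 1) + 2 * (j : ℤ) :=
    fun j _ => by ring
  rw [prod_congr rfl e, hw]
  have hf : (n ! : ℚ) ≠ 0 := by exact_mod_cast Nat.factorial_ne_zero n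
  push_cast
  field_simp

/-- **The half-integer brick is `IsDInt (d_n)` at every integer**: `d_n^j (1/j!) (halfBrick c n)^{(j)}(k) ∈ ℤ`
for all `j` — it is an integer-valued polynomial of degree `n`.
[cite: RivoalZudilin2020, §3 (proof of Proposition 1 (ii), "mutatis mutandis [zud2]")] -/
theorem halfBrick_isDInt (c : ℤ) (n : ℕ) (k : ℤ) (N : ℕ) :
    IsDInt (Nat.lcmUpto n) N (halfBrick c n) k := by
  have h := isDInt_eval_of_intValued (halfBrickPoly c n) (natDegree_halfBrickPoly_le c n)
    (fun i _ => by rw [eval_halfBrickPoly]; exact_mod_cast halfBrick_intCast_isInt c n i) k N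
  refine h.congr (Eventually.of_forall fun t => ?_)
  exact eval_halfBrickPoly c n t

/-! ### The bricks of `R(t)(t+m)^A` -/

/-- `G(t)(t+m) = n!(t+m)/(t)_{n+1} = n!/∏_{k ≤ n, k ≠ m}(t+k)` (regular at `−m`): the tree's regularised
reciprocal brick `recipBrickReg 0 (n+1) m`. [cite: RivoalZudilin2020, §3 (proof of Proposition 1 (ii), G(t) = n!/(t)_{n+1})] -/
def Greg (n m : ℕ) : ℚ → ℚ := recipBrickReg 0 (n + 1) (m : ℤ)

/-- `Greg` unfolded: `n! · ∏_{l ≤ n, l ≠ m} (t + l)⁻¹` (for `m ≤ n`).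
[cite: RivoalZudilin2020, §3 (proof of Proposition 1 (ii))] -/
theorem Greg_eq (n : ℕ) {m : ℕ} (hm : m ≤ n) (t : ℚ) :
    Greg n m t = (n ! : ℚ) * ∏ l ∈ (range (n + 1)).filter (fun l => l ≠ m), (t + l)⁻¹ := by
  rw [Greg, recipBrickReg, Nat.add_sub_cancel, if_pos ⟨by exact_mod_cast Nat.zero_le m, by push_cast; omega⟩,
    mul_one]
  congr 1
  have hs : (range (n + 1)).filter (fun l : ℕ => (0 : ℤ) + (l : ℤ) ≠ (m : ℤ))
      = (range (n + 1)).filter (fun l => l ≠ m) := by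
    ext l
    simp only [mem_filter, mem_range, zero_add]
    exact ⟨fun ⟨h1, h2⟩ => ⟨h1, fun h => h2 (by exact_mod_cast h)⟩,
      fun ⟨h1, h2⟩ => ⟨h1, fun h => h2 (by exact_mod_cast h)⟩⟩
  rw [hs]
  refine prod_congr rfl fun l _ => ?_
  push_cast; ring

/-- `d_n^j (1/j!) (G(t)(t+m))^{(j)}|_{t=−m} ∈ ℤ` ([Zudilin2004, Lemma 16] with `a₀ = 0`, `b₀ = n+1`).
[cite: RivoalZudilin2020, §3 (proof of Proposition 1 (ii), display "d_n^k (1/k!)(G(t)(t+m))^{(k)} ∈ ℤ")] -/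
theorem Greg_isDInt (n : ℕ) {m : ℕ} (hm : m ≤ n) (N : ℕ) :
    IsDInt (Nat.lcmUpto n) N (Greg n m) (-(m : ℚ)) := by
  have h := recipBrickReg_isDInt (a₀ := 0) (b₀ := (n : ℤ) + 1) (a := 0) (m := n + 1) (by omega) le_rfl
    (by omega) (k := (m : ℤ)) (by exact_mod_cast Nat.zero_le m) (by omega) N
  have e : ((n : ℤ) + 1 - 0 - 1).toNat = n := by omega
  rw [e] at h
  simpa [Greg] using h

/-- `F(t)(t+m)^5` in BRICK FORM:
`(t−n)_n/n! · (t+n+1)_n/n! · ∏_{c ∈ {−n,0,n}} 2^{2n}(t+c+½)_n/n! · (G(t)(t+m))^5`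
(`= 2^{6n}(t−n)_n(t+n+1)_n(t−n+½)_{3n}(t+m)^5/(t)_{n+1}^5` off the other poles).
[cite: RivoalZudilin2020, §3 (proof of Proposition 1 (ii), F(t))] -/
def Fbrick (n m : ℕ) (t : ℚ) : ℚ :=
  polyBrick (-(n : ℤ)) n t * polyBrick ((n : ℤ) + 1) n t *
    (halfBrick (-(n : ℤ)) n t * halfBrick 0 n t * halfBrick (n : ℤ) n t) * Greg n m t ^ 5

/-- `R(t)(t+m)^A = (2t+n) · (F(t)(t+m)^5)³ · (G(t)(t+m))^{A−15}` in brick form (regular at `−m`).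
[cite: RivoalZudilin2020, §3 (proof of Proposition 1 (ii), R(t) = (2t+n)F(t)³G(t)^{A−15})] -/
def RregBrick (A n m : ℕ) (t : ℚ) : ℚ :=
  (2 * t + n) * Fbrick n m t ^ 3 * Greg n m t ^ (A - 15)

/-- `d_n^j (1/j!) (F(t)(t+m)^5)^{(j)}|_{t=−m} ∈ ℤ` for all `j` (Leibniz over the bricks).
[cite: RivoalZudilin2020, §3 (proof of Proposition 1 (ii), display "Φ_n^{-1} d_n^k (1/k!)(F(t)(t+m)^5)^{(k)} ∈ ℤ", its d_n-part)] -/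
theorem Fbrick_isDInt (n : ℕ) {m : ℕ} (hm : m ≤ n) (N : ℕ) :
    IsDInt (Nat.lcmUpto n) N (Fbrick n m) (-(m : ℚ)) := by
  have h1 := polyBrick_isDInt_neg (-(n : ℤ)) n (m : ℤ) N
  have h2 := polyBrick_isDInt_neg ((n : ℤ) + 1) n (m : ℤ) N
  have h3 : ∀ c : ℤ, IsDInt (Nat.lcmUpto n) N (halfBrick c n) (-(m : ℚ)) := fun c => by
    simpa using halfBrick_isDInt c n (-(m : ℤ)) N
  have h4 := (Greg_isDInt n hm N).pow 5
  simp only [Int.cast_natCast] at h1 h2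
  exact ((h1.mul h2).mul (((h3 _).mul (h3 _)).mul (h3 _))).mul h4

/-- **`d_n^j (1/j!) (R(t)(t+m)^A)^{(j)}|_{t=−m} ∈ ℤ` for all `j`** — the inclusions
"`d_n^{A−j} p_{j,m} ∈ ℤ` for any `j ∈ {1,…,A}` and any `m ∈ {0,…,n}`" of [RivoalZudilin2020, §3] for the
brick form (the typed coefficient `p_{j,m}` is the divided derivative of order `A − j`, see
`DenominatorsTransfer.lean`). [cite: RivoalZudilin2020, §3 (proof of Proposition 1 (ii), "d_n^{A-j} p_{j,m} ∈ ℤ")] -/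
theorem RregBrick_isDInt (A n : ℕ) {m : ℕ} (hm : m ≤ n) (N : ℕ) :
    IsDInt (Nat.lcmUpto n) N (RregBrick A n m) (-(m : ℚ)) := by
  have hlin : IsDInt (Nat.lcmUpto n) N (fun t : ℚ => 2 * t + n) (-(m : ℚ)) := by
    have := IsDInt.linear (Nat.lcmUpto n) N 2 (n : ℤ) (-(m : ℤ))
    simpa using this
  exact (hlin.mul ((Fbrick_isDInt n hm N).pow 3)).mul ((Greg_isDInt n hm N).pow (A - 15))

/-- The integrality in the form used downstream: for every `a`, `d_n^a · 𝒟_a (R(t)(t+m)^A)(−m)` is an integer.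
[cite: RivoalZudilin2020, §3 (proof of Proposition 1 (ii), "d_n^{A-j} p_{j,m} ∈ ℤ")] -/
theorem exists_int_lcm_pow_mul_divDeriv_RregBrick (A n : ℕ) {m : ℕ} (hm : m ≤ n) (a : ℕ) :
    ∃ z : ℤ, ((Nat.lcmUpto n : ℕ) : ℚ) ^ a * divDeriv a (RregBrick A n m) (-(m : ℚ)) = z :=
  (RregBrick_isDInt A n hm a).isInt a le_rfl

end Literature.NumberTheory.Irrationality.RivoalZudilin2020
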